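import Literature.IUT.HodgeTheaters.GenuineFKitMergeInputsAssembly
import HarnessLib

/-!
# [IUTchI] Def 3.1 (e)(f) / Def 6.1 (v) / Cor 5.3 (ii): the automorphisms `φ_n` of `Π_v̲ = Π_{(−)} ×_{G_F} Γ` and `ᾱ_n` of
# `Γ = Gal(K̄_v̲/K_v̲)` induced by a TRANSPORTER `n ∈ N_{Π_{C_F}}(Π_v̲)` — group theory and topology (FILE 1 of abc-iut-w4-d047's
# support row «LIFTSALL-SIGMA@GOOD»; FILE 2 = `GoodLocalFrobenioidTransporterSigma`)

S. Mochizuki, *Inter-universal Teichmüller theory I*, kurims manuscript (May 2020), Def 3.1 (e)(f) pp. 62–63 (`Π_v̲ := Π_{X̲→_v̲}`,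
«natural outer surjections onto the decomposition group `G_v ⊆ G_K`»), Def 6.1 (v) p. 158 (ambient automorphisms act on the embedded
`Π`'s by conjugation), §5 Corollary 5.3 (ii) p. 144 l. 13–15 and its printed proof p. 144 l. 33–34 («follows immediately from
[AbsTopIII], Proposition 3.2, (iv); [AbsTopIII], Proposition 4.2, (i)»; doc v2: second attribution restored per referee N24-F1, read on my render) ([IUTchI] Def 3.1 (e) p.62) [claim: Mochizuki2012, status: disputed] (D-0012 claim key, series status
DISPUTED — GROUP-THEORETIC PLUMBING over abc-iut-L5-t2's `PiLoc`/`augLoc` and racer B's `piLocEquiv`; nothing of the series is asserted;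
no side is taken on [IUTchIII] Cor. 3.12).

## What this file builds (cell abc-iut, L5 HUB node `IUTchI:Cor5.3(ii)`; the group-theoretic half of the input for the LiftsAll target
## `goodLiftsAllAt_iff` of abc-iut-L5-t16 (p501097) at the NON-Γ-inner transporters)

GENERIC in `(D, H ≤ Π_{C_F}, ρ : Γ →* G_F)` with `ρ` injective and `ρ(Γ) ⊆ augGF(H)` (at the place: `H = Π_{X̲→_K}`, `Γ = Gal(K̄_v̲/K_v̲)`,
`ρ = localToGF`), for `n` in the normaliser of `S := H ⊓ augGF⁻¹(ρ(Γ))` (= racer B's seam form of the kit's `Π_v̲`):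
* `InitialThetaData.galTransporter n : Γ ≃* Γ` — THE automorphism of `Γ` with `ρ (galTransporter n γ) = augGF n · ρ γ · (augGF n)⁻¹`
  (`augGF n` normalises `ρ(Γ)` since `augGF(S) = ρ(Γ)`, `map_augGF_inf_comap_range`); multiplicative in `n` (`galTransporter_mul/_one`);
  `galTransporter_apply_of_augGF_eq` — for a Γ-INNER transporter (`augGF n = ρ γ₀`, abc-iut-L5-t16's class) it is the inner automorphism of `γ₀`;
* `InitialThetaData.transporterEquiv n : PiLoc ≃* PiLoc` — racer B's `piLocEquiv`-conjugate of `PiTransport.conjSub S n` (abc-iut-L5-t16's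
  «`φ_n := e⁻¹ ∘ conj_n ∘ e`», = the `MulEquiv` of its `transporterEnd`), `transporterEquiv_fst` (`= n · z · n⁻¹` on the `Π_{C_F}`-coordinate),
  **`augLoc_transporterEquiv : augLoc (φ_n z) = galTransporter n (augLoc z)`**, `map_ker_augLoc_transporterEquiv` (the `actionKer`
  hypothesis of the L4 lifting theorems);
* continuity: `continuous_transporterEquiv` (homeomorphic `piLocEquiv`), **`continuous_galTransporter`** (from the OPENNESS of `augLoc`,
  abc-iut-L5-t2 `isOpenMap_augLoc`), packaged as `transporterCEquiv n : PiLoc ≃ₜ* PiLoc`, `galTransporterCEquiv n : Γ ≃ₜ* Γ` — the latter is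
  the `α : Gal(k̄/k) ≃ₜ* Gal(k̄/k)` that [AbsAnab] Prop 1.2.1 (vi) (abc-iut-L4-d3 `Prop121vii.unitsTransport_holds`) eats in FILE 2.
Binders: `hinj`, `hH`, and for continuity `[CompactSpace Γ]`, `hX : IsOpen H`, `ρ` continuous; 0 instance · 0 notation · no `Prop` fact;
defs `galTransporterFun/Hom`, `galTransporter(CEquiv)`, `transporterEquiv`, `transporterCEquiv`.  HONEST FRAMING: OUR automorphisms of OUR
groups; typed ≠ proved beyond what is here; nothing here asserts abc proved or refuted.
-/

noncomputable section

namespace Literature.IUT.HodgeTheaters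

open Literature.AnabelianGeometry.SemiGraphs

/-! ### §1. Transporters of `Π_v̲ = Π_{(−)} ×_{G_F} Γ`: the induced automorphisms of `Π_v̲` and of `Γ` -/

namespace InitialThetaData

section Transporter

universe u v

variable {F : Type u} {K : Type v} {Fbar : Type} [Field F] [NumberField F] [Field K] [NumberField K]
  [Algebra F K] [Field Fbar] [Algebra F Fbar] [Algebra K Fbar]
  {E : WeierstrassCurve F} [E.IsElliptic] {l : ℕ} {Pb : BadPlacePredicates K}
  (D : InitialThetaData F K Fbar E l Pb) (H : Subgroup D.PiC)
  {Γ : Type} [Group Γ] [TopologicalSpace Γ] (ρ : Γ →* (Fbar ≃ₐ[F] Fbar))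

omit [TopologicalSpace Γ] in
/-- `augGF` maps `S = Π_{(−)} ∩ augGF⁻¹(ρ(Γ))` ONTO `ρ(Γ)` when `ρ(Γ) ⊆ augGF(Π_{(−)})` (Def 3.1 (e) «natural outer surjections
onto the decomposition group»). ([IUTchI] Def 3.1 (e) p.62) [claim: Mochizuki2012, status: disputed] -/
theorem map_augGF_inf_comap_range (hH : ρ.range ≤ H.map D.augGF) : (H ⊓ ρ.range.comap D.augGF).map D.augGF = ρ.range := by
  apply le_antisymm
  · rintro _ ⟨y, hy, rfl⟩
    exact Subgroup.mem_comap.mp (Subgroup.mem_inf.mp hy).2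
  · intro g hg
    obtain ⟨y, hy, hyg⟩ := hH hg
    exact ⟨y, Subgroup.mem_inf.mpr ⟨hy, Subgroup.mem_comap.mpr (hyg ▸ hg)⟩, hyg⟩

omit [TopologicalSpace Γ] in
/-- A transporter `n ∈ N_{Π_{C_F}}(S)`, `S = Π_{(−)} ∩ augGF⁻¹(ρ(Γ))`, has `augGF n` normalising `ρ(Γ)`:
`augGF n · ρ γ · (augGF n)⁻¹ ∈ ρ(Γ)`. ([IUTchI] Def 6.1 (v) p.158) [claim: Mochizuki2012, status: disputed] -/
theorem conj_augGF_mem_range (hH : ρ.range ≤ H.map D.augGF)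
    (n : ↥(Subgroup.normalizer ((H ⊓ ρ.range.comap D.augGF : Subgroup D.PiC) : Set D.PiC))) (γ : Γ) :
    D.augGF (n : D.PiC) * ρ γ * (D.augGF (n : D.PiC))⁻¹ ∈ ρ.range := by
  have hγ : ρ γ ∈ (H ⊓ ρ.range.comap D.augGF).map D.augGF := by
    rw [D.map_augGF_inf_comap_range H ρ hH]; exact ⟨γ, rfl⟩
  obtain ⟨y, hy, hyγ⟩ := hγ
  have hny : (n : D.PiC) * y * (n : D.PiC)⁻¹ ∈ H ⊓ ρ.range.comap D.augGF :=
    (Subgroup.mem_normalizer_iff.mp n.2 y).mp hy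
  have h2 := Subgroup.mem_comap.mp (Subgroup.mem_inf.mp hny).2
  rwa [map_mul, map_mul, map_inv, hyγ] at h2

/-- **THE automorphism of `Γ = Gal(K̄_v̲/K_v̲)` induced by a transporter `n`, on elements**: `γ ↦ ρ⁻¹(augGF n · ρ γ · (augGF n)⁻¹)`
(`ρ` injective = Krasner density at the place, racer B `localToGF_injective_at`).  For Γ-inner `n` this is inner; in general
it is the automorphism by which `N_{G_F}(G_v̲)` acts (Def 6.1 (v)). ([IUTchI] Def 6.1 (v) p.158) [claim: Mochizuki2012, status: disputed] -/
def galTransporterFun (hinj : Function.Injective ρ) (hH : ρ.range ≤ H.map D.augGF)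
    (n : ↥(Subgroup.normalizer ((H ⊓ ρ.range.comap D.augGF : Subgroup D.PiC) : Set D.PiC))) (γ : Γ) : Γ :=
  (MonoidHom.ofInjective hinj).symm ⟨_, D.conj_augGF_mem_range H ρ hH n γ⟩

omit [TopologicalSpace Γ] in
/-- The defining identity of the underlying function: `ρ (galTransporterFun n γ) = augGF n · ρ γ · (augGF n)⁻¹`.
([IUTchI] Def 6.1 (v) p.158) [claim: Mochizuki2012, status: disputed] -/
theorem rho_galTransporterFun (hinj : Function.Injective ρ) (hH : ρ.range ≤ H.map D.augGF)
    (n : ↥(Subgroup.normalizer ((H ⊓ ρ.range.comap D.augGF : Subgroup D.PiC) : Set D.PiC))) (γ : Γ) :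
    ρ (D.galTransporterFun H ρ hinj hH n γ) = D.augGF (n : D.PiC) * ρ γ * (D.augGF (n : D.PiC))⁻¹ :=
  MonoidHom.apply_ofInjective_symm _ _

/-- **THE automorphism of `Γ = Gal(K̄_v̲/K_v̲)` induced by a transporter `n`, as a homomorphism** (`galTransporterFun` is
multiplicative: compute in `G_F` through the injective `ρ`). ([IUTchI] Def 6.1 (v) p.158) [claim: Mochizuki2012, status: disputed] -/
def galTransporterHom (hinj : Function.Injective ρ) (hH : ρ.range ≤ H.map D.augGF)
    (n : ↥(Subgroup.normalizer ((H ⊓ ρ.range.comap D.augGF : Subgroup D.PiC) : Set D.PiC))) : Γ →* Γ where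
  toFun := D.galTransporterFun H ρ hinj hH n
  map_one' := by
    apply hinj
    rw [D.rho_galTransporterFun, map_one, mul_one, mul_inv_cancel]
  map_mul' γ δ := by
    apply hinj
    rw [map_mul, D.rho_galTransporterFun, D.rho_galTransporterFun, D.rho_galTransporterFun, map_mul]
    group

omit [TopologicalSpace Γ] in
/-- The defining identity `ρ (galTransporterHom n γ) = augGF n · ρ γ · (augGF n)⁻¹`. ([IUTchI] Def 6.1 (v) p.158) [claim: Mochizuki2012, status: disputed] -/
theorem rho_galTransporterHom (hinj : Function.Injective ρ) (hH : ρ.range ≤ H.map D.augGF)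
    (n : ↥(Subgroup.normalizer ((H ⊓ ρ.range.comap D.augGF : Subgroup D.PiC) : Set D.PiC))) (γ : Γ) :
    ρ (D.galTransporterHom H ρ hinj hH n γ) = D.augGF (n : D.PiC) * ρ γ * (D.augGF (n : D.PiC))⁻¹ :=
  D.rho_galTransporterFun H ρ hinj hH n γ

omit [TopologicalSpace Γ] in
/-- `galTransporterHom` is multiplicative in `n`. ([IUTchI] Def 6.1 (v) p.158) [claim: Mochizuki2012, status: disputed] -/
theorem galTransporterHom_mul (hinj : Function.Injective ρ) (hH : ρ.range ≤ H.map D.augGF)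
    (n m : ↥(Subgroup.normalizer ((H ⊓ ρ.range.comap D.augGF : Subgroup D.PiC) : Set D.PiC))) :
    D.galTransporterHom H ρ hinj hH (n * m) = (D.galTransporterHom H ρ hinj hH n).comp (D.galTransporterHom H ρ hinj hH m) := by
  ext γ
  apply hinj
  rw [MonoidHom.comp_apply, D.rho_galTransporterHom, D.rho_galTransporterHom, D.rho_galTransporterHom, Subgroup.coe_mul,
    map_mul]
  group

omit [TopologicalSpace Γ] in
/-- `galTransporterHom 1 = id`. ([IUTchI] Def 6.1 (v) p.158) [claim: Mochizuki2012, status: disputed] -/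
theorem galTransporterHom_one (hinj : Function.Injective ρ) (hH : ρ.range ≤ H.map D.augGF) :
    D.galTransporterHom H ρ hinj hH 1 = MonoidHom.id Γ := by
  ext γ
  apply hinj
  rw [D.rho_galTransporterHom, OneMemClass.coe_one, map_one, one_mul, inv_one, mul_one, MonoidHom.id_apply]

/-- **`galTransporter n : Γ ≃* Γ`** (inverse `galTransporterHom n⁻¹`). ([IUTchI] Def 6.1 (v) p.158) [claim: Mochizuki2012, status: disputed] -/
def galTransporter (hinj : Function.Injective ρ) (hH : ρ.range ≤ H.map D.augGF)
    (n : ↥(Subgroup.normalizer ((H ⊓ ρ.range.comap D.augGF : Subgroup D.PiC) : Set D.PiC))) : Γ ≃* Γ :=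
  MonoidHom.toMulEquiv (D.galTransporterHom H ρ hinj hH n) (D.galTransporterHom H ρ hinj hH n⁻¹)
    (by rw [← D.galTransporterHom_mul, inv_mul_cancel, D.galTransporterHom_one])
    (by rw [← D.galTransporterHom_mul, mul_inv_cancel, D.galTransporterHom_one])

omit [TopologicalSpace Γ] in
/-- `ρ (galTransporter n γ) = augGF n · ρ γ · (augGF n)⁻¹`. ([IUTchI] Def 6.1 (v) p.158) [claim: Mochizuki2012, status: disputed] -/
@[simp] theorem rho_galTransporter (hinj : Function.Injective ρ) (hH : ρ.range ≤ H.map D.augGF)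
    (n : ↥(Subgroup.normalizer ((H ⊓ ρ.range.comap D.augGF : Subgroup D.PiC) : Set D.PiC))) (γ : Γ) :
    ρ (D.galTransporter H ρ hinj hH n γ) = D.augGF (n : D.PiC) * ρ γ * (D.augGF (n : D.PiC))⁻¹ :=
  D.rho_galTransporterHom H ρ hinj hH n γ

omit [TopologicalSpace Γ] in
/-- `galTransporter (n * m) = galTransporter m ≫ galTransporter n` (multiplicativity, in `MulEquiv.trans` order).
([IUTchI] Def 6.1 (v) p.158) [claim: Mochizuki2012, status: disputed] -/
theorem galTransporter_mul (hinj : Function.Injective ρ) (hH : ρ.range ≤ H.map D.augGF)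
    (n m : ↥(Subgroup.normalizer ((H ⊓ ρ.range.comap D.augGF : Subgroup D.PiC) : Set D.PiC))) :
    D.galTransporter H ρ hinj hH (n * m) = (D.galTransporter H ρ hinj hH m).trans (D.galTransporter H ρ hinj hH n) := by
  ext γ
  change D.galTransporterHom H ρ hinj hH (n * m) γ = D.galTransporterHom H ρ hinj hH n (D.galTransporterHom H ρ hinj hH m γ)
  rw [D.galTransporterHom_mul, MonoidHom.comp_apply]

omit [TopologicalSpace Γ] in
/-- `galTransporter 1 = 1`. ([IUTchI] Def 6.1 (v) p.158) [claim: Mochizuki2012, status: disputed] -/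
theorem galTransporter_one (hinj : Function.Injective ρ) (hH : ρ.range ≤ H.map D.augGF) :
    D.galTransporter H ρ hinj hH 1 = MulEquiv.refl Γ := by
  ext γ
  change D.galTransporterHom H ρ hinj hH 1 γ = γ
  rw [D.galTransporterHom_one, MonoidHom.id_apply]

omit [TopologicalSpace Γ] in
/-- `(galTransporter n)⁻¹ = galTransporter n⁻¹` on elements. ([IUTchI] Def 6.1 (v) p.158) [claim: Mochizuki2012, status: disputed] -/
theorem galTransporter_symm_apply (hinj : Function.Injective ρ) (hH : ρ.range ≤ H.map D.augGF)
    (n : ↥(Subgroup.normalizer ((H ⊓ ρ.range.comap D.augGF : Subgroup D.PiC) : Set D.PiC))) (γ : Γ) :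
    (D.galTransporter H ρ hinj hH n).symm γ = D.galTransporter H ρ hinj hH n⁻¹ γ := rfl

omit [TopologicalSpace Γ] in
/-- **A transporter with `augGF n = ρ γ₀` acts on `Γ` by the INNER automorphism of `γ₀`** (the Γ-inner case of abc-iut-L5-t16's
census; then the transport `pull` of it is `≅ 𝟭`). ([IUTchI] Def 6.1 (v) p.158) [claim: Mochizuki2012, status: disputed] -/
theorem galTransporter_apply_of_augGF_eq (hinj : Function.Injective ρ) (hH : ρ.range ≤ H.map D.augGF)
    (n : ↥(Subgroup.normalizer ((H ⊓ ρ.range.comap D.augGF : Subgroup D.PiC) : Set D.PiC))) (γ₀ : Γ)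
    (hn : D.augGF (n : D.PiC) = ρ γ₀) (γ : Γ) : D.galTransporter H ρ hinj hH n γ = γ₀ * γ * γ₀⁻¹ := by
  apply hinj
  rw [D.rho_galTransporter, hn, map_mul, map_mul, map_inv]

/-- **THE automorphism `φ_n` of `Π_v̲ = Π_{(−)} ×_{G_F} Γ` induced by a transporter `n`**: racer B's `piLocEquiv` (`Π_v̲ ≃* S`,
first projection) conjugate of `PiTransport.conjSub S n` (`x ↦ n x n⁻¹`) — abc-iut-L5-t16's «`φ_n := e⁻¹ ∘ conj_n ∘ e`».
([IUTchI] Def 6.1 (v) p.158) [claim: Mochizuki2012, status: disputed] -/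
def transporterEquiv (hinj : Function.Injective ρ)
    (n : ↥(Subgroup.normalizer ((H ⊓ ρ.range.comap D.augGF : Subgroup D.PiC) : Set D.PiC))) : D.PiLoc H ρ ≃* D.PiLoc H ρ :=
  ((D.piLocEquiv H ρ hinj).trans
      (MonoidHom.toMulEquiv (PiTransport.conjSub _ n) (PiTransport.conjSub _ n⁻¹) (PiTransport.conjSub_inv_comp _ n)
        (PiTransport.conjSub_comp_inv _ n))).trans
    (D.piLocEquiv H ρ hinj).symm

omit [TopologicalSpace Γ] in
/-- The `Π_{C_F}`-component of `piLocEquiv⁻¹ y` is `y` itself. ([IUTchI] Def 3.1 (e) p.62) [claim: Mochizuki2012, status: disputed] -/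
theorem piLocEquiv_symm_fst (hinj : Function.Injective ρ) (y : ↥(H ⊓ ρ.range.comap D.augGF)) :
    ((D.piLocEquiv H ρ hinj).symm y).1.1 = (y : D.PiC) := by
  rw [← D.coe_piLocEquiv H ρ hinj ((D.piLocEquiv H ρ hinj).symm y), MulEquiv.apply_symm_apply]

omit [TopologicalSpace Γ] in
/-- **`φ_n` on the `Π_{C_F}`-component is conjugation by `n`**: `(φ_n z).1.1 = n · z.1.1 · n⁻¹`.
([IUTchI] Def 6.1 (v) p.158) [claim: Mochizuki2012, status: disputed] -/
@[simp] theorem transporterEquiv_fst (hinj : Function.Injective ρ)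
    (n : ↥(Subgroup.normalizer ((H ⊓ ρ.range.comap D.augGF : Subgroup D.PiC) : Set D.PiC))) (z : D.PiLoc H ρ) :
    (D.transporterEquiv H ρ hinj n z).1.1 = (n : D.PiC) * z.1.1 * (n : D.PiC)⁻¹ := by
  change ((D.piLocEquiv H ρ hinj).symm (PiTransport.conjSub _ n (D.piLocEquiv H ρ hinj z))).1.1 = _
  rw [D.piLocEquiv_symm_fst, PiTransport.coe_conjSub, D.coe_piLocEquiv]

omit [TopologicalSpace Γ] in
/-- `φ_n⁻¹ = φ_{n⁻¹}` on elements. ([IUTchI] Def 6.1 (v) p.158) [claim: Mochizuki2012, status: disputed] -/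
theorem transporterEquiv_symm_apply (hinj : Function.Injective ρ)
    (n : ↥(Subgroup.normalizer ((H ⊓ ρ.range.comap D.augGF : Subgroup D.PiC) : Set D.PiC))) (z : D.PiLoc H ρ) :
    (D.transporterEquiv H ρ hinj n).symm z = D.transporterEquiv H ρ hinj n⁻¹ z := by
  rw [MulEquiv.symm_apply_eq]
  apply D.fstLoc_injective H ρ hinj
  rw [D.fstLoc_apply, D.fstLoc_apply, D.transporterEquiv_fst, D.transporterEquiv_fst, Subgroup.coe_inv]
  group

omit [TopologicalSpace Γ] in
/-- **`φ_n` COVERS `galTransporter n` on `Γ`**: `augLoc (φ_n z) = galTransporter n (augLoc z)` (the square over `G_F`: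
`ρ ∘ augLoc = augGF ∘ fstLoc`, and `ρ` is injective). ([IUTchI] Def 3.1 (e) p.62) [claim: Mochizuki2012, status: disputed] -/
theorem augLoc_transporterEquiv (hinj : Function.Injective ρ) (hH : ρ.range ≤ H.map D.augGF)
    (n : ↥(Subgroup.normalizer ((H ⊓ ρ.range.comap D.augGF : Subgroup D.PiC) : Set D.PiC))) (z : D.PiLoc H ρ) :
    D.augLoc H ρ (D.transporterEquiv H ρ hinj n z) = D.galTransporter H ρ hinj hH n (D.augLoc H ρ z) := by
  apply hinj
  have h1 := D.augGF_fstLoc H ρ (D.transporterEquiv H ρ hinj n z)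
  have h2 := D.augGF_fstLoc H ρ z
  rw [D.fstLoc_apply] at h1 h2
  rw [D.rho_galTransporter, ← h1, ← h2, D.transporterEquiv_fst, map_mul, map_mul, map_inv]

omit [TopologicalSpace Γ] in
/-- `φ_n` preserves `Ker(Π_v̲ ↠ Γ)` (= `Δ_{(−)}`, abc-iut-L5-t2 `kerAugLocEquiv`): the `actionKer` hypothesis of the L4 lifting
theorems. ([IUTchI] Def 3.1 (e) p.62) [claim: Mochizuki2012, status: disputed] -/
theorem map_ker_augLoc_transporterEquiv (hinj : Function.Injective ρ) (hH : ρ.range ≤ H.map D.augGF)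
    (n : ↥(Subgroup.normalizer ((H ⊓ ρ.range.comap D.augGF : Subgroup D.PiC) : Set D.PiC))) :
    (D.augLoc H ρ).ker.map (D.transporterEquiv H ρ hinj n).toMonoidHom = (D.augLoc H ρ).ker := by
  have key : ∀ (m : ↥(Subgroup.normalizer ((H ⊓ ρ.range.comap D.augGF : Subgroup D.PiC) : Set D.PiC))) (z : D.PiLoc H ρ),
      z ∈ (D.augLoc H ρ).ker → D.transporterEquiv H ρ hinj m z ∈ (D.augLoc H ρ).ker := by
    intro m z hz
    rw [MonoidHom.mem_ker] at hz ⊢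
    rw [D.augLoc_transporterEquiv H ρ hinj hH, hz, map_one]
  apply le_antisymm
  · rintro _ ⟨z, hz, rfl⟩
    exact key n z hz
  · intro z hz
    refine ⟨(D.transporterEquiv H ρ hinj n).symm z, ?_, MulEquiv.apply_symm_apply _ _⟩
    rw [SetLike.mem_coe, D.transporterEquiv_symm_apply]
    exact key n⁻¹ z hz

variable [CompactSpace Γ]

/-- `φ_n` is continuous (`piLocEquiv` is a homeomorphism for open `Π_{(−)}`, continuous `ρ`, compact `Γ`; conjugation is continuous).
([IUTchI] Def 6.1 (v) p.158) [claim: Mochizuki2012, status: disputed] -/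
theorem continuous_transporterEquiv (hinj : Function.Injective ρ) (hX : IsOpen (H : Set D.PiC)) (hρc : Continuous ρ)
    (n : ↥(Subgroup.normalizer ((H ⊓ ρ.range.comap D.augGF : Subgroup D.PiC) : Set D.PiC))) :
    Continuous (D.transporterEquiv H ρ hinj n) :=
  (D.continuous_piLocEquiv_symm H ρ hX hρc hinj).comp
    ((PiTransport.continuous_conjSub _ n).comp (D.continuous_piLocEquiv H ρ hinj))

/-- **`φ_n` as an isomorphism of TOPOLOGICAL groups** `Π_v̲ ≃ₜ* Π_v̲`. ([IUTchI] Def 6.1 (v) p.158) [claim: Mochizuki2012, status: disputed] -/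
def transporterCEquiv (hinj : Function.Injective ρ) (hX : IsOpen (H : Set D.PiC)) (hρc : Continuous ρ)
    (n : ↥(Subgroup.normalizer ((H ⊓ ρ.range.comap D.augGF : Subgroup D.PiC) : Set D.PiC))) : D.PiLoc H ρ ≃ₜ* D.PiLoc H ρ where
  toMulEquiv := D.transporterEquiv H ρ hinj n
  continuous_toFun := D.continuous_transporterEquiv H ρ hinj hX hρc n
  continuous_invFun := by
    have heq : ⇑(D.transporterEquiv H ρ hinj n).symm = D.transporterEquiv H ρ hinj n⁻¹ :=
      funext fun z => D.transporterEquiv_symm_apply H ρ hinj n z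
    change Continuous ⇑(D.transporterEquiv H ρ hinj n).symm
    rw [heq]
    exact D.continuous_transporterEquiv H ρ hinj hX hρc n⁻¹

/-- `transporterCEquiv n` IS `transporterEquiv n` on elements. ([IUTchI] Def 6.1 (v) p.158) [claim: Mochizuki2012, status: disputed] -/
@[simp] theorem transporterCEquiv_apply (hinj : Function.Injective ρ) (hX : IsOpen (H : Set D.PiC)) (hρc : Continuous ρ)
    (n : ↥(Subgroup.normalizer ((H ⊓ ρ.range.comap D.augGF : Subgroup D.PiC) : Set D.PiC))) (z : D.PiLoc H ρ) :
    D.transporterCEquiv H ρ hinj hX hρc n z = D.transporterEquiv H ρ hinj n z := rfl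

/-- **`galTransporter n` is CONTINUOUS** — because `augLoc` is an OPEN surjection covering it (abc-iut-L5-t2 `isOpenMap_augLoc`,
`augLoc_surjective`): the preimage of an open set is the `augLoc`-image of an open set.
([IUTchI] Def 3.1 (e) p.62) [claim: Mochizuki2012, status: disputed] -/
theorem continuous_galTransporter (hinj : Function.Injective ρ) (hH : ρ.range ≤ H.map D.augGF) (hX : IsOpen (H : Set D.PiC))
    (hρc : Continuous ρ) (n : ↥(Subgroup.normalizer ((H ⊓ ρ.range.comap D.augGF : Subgroup D.PiC) : Set D.PiC))) :
    Continuous (D.galTransporter H ρ hinj hH n) := by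
  have hs := D.augLoc_surjective H ρ hH
  have ho := D.isOpenMap_augLoc H ρ hX hρc
  refine continuous_def.mpr fun V hV => ?_
  have hpre : (D.galTransporter H ρ hinj hH n) ⁻¹' V =
      D.augLoc H ρ '' ((D.transporterEquiv H ρ hinj n) ⁻¹' (D.augLoc H ρ ⁻¹' V)) := by
    ext γ
    constructor
    · intro hγ
      obtain ⟨z, rfl⟩ := hs γ
      refine ⟨z, ?_, rfl⟩
      show D.augLoc H ρ (D.transporterEquiv H ρ hinj n z) ∈ V
      rwa [D.augLoc_transporterEquiv H ρ hinj hH]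
    · rintro ⟨z, hz, rfl⟩
      show D.galTransporter H ρ hinj hH n (D.augLoc H ρ z) ∈ V
      rw [← D.augLoc_transporterEquiv H ρ hinj hH]
      exact hz
  rw [hpre]
  exact ho _ ((hV.preimage (D.continuous_augLoc H ρ)).preimage (D.continuous_transporterEquiv H ρ hinj hX hρc n))

/-- **`galTransporter n` as an isomorphism of TOPOLOGICAL groups** `Γ ≃ₜ* Γ`. ([IUTchI] Def 6.1 (v) p.158) [claim: Mochizuki2012, status: disputed] -/
def galTransporterCEquiv (hinj : Function.Injective ρ) (hH : ρ.range ≤ H.map D.augGF) (hX : IsOpen (H : Set D.PiC))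
    (hρc : Continuous ρ) (n : ↥(Subgroup.normalizer ((H ⊓ ρ.range.comap D.augGF : Subgroup D.PiC) : Set D.PiC))) : Γ ≃ₜ* Γ where
  toMulEquiv := D.galTransporter H ρ hinj hH n
  continuous_toFun := D.continuous_galTransporter H ρ hinj hH hX hρc n
  continuous_invFun := by
    have heq : ⇑(D.galTransporter H ρ hinj hH n).symm = D.galTransporter H ρ hinj hH n⁻¹ :=
      funext fun γ => D.galTransporter_symm_apply H ρ hinj hH n γ
    change Continuous ⇑(D.galTransporter H ρ hinj hH n).symm
    rw [heq]
    exact D.continuous_galTransporter H ρ hinj hH hX hρc n⁻¹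

/-- `galTransporterCEquiv n` IS `galTransporter n` on elements. ([IUTchI] Def 6.1 (v) p.158) [claim: Mochizuki2012, status: disputed] -/
@[simp] theorem galTransporterCEquiv_apply (hinj : Function.Injective ρ) (hH : ρ.range ≤ H.map D.augGF)
    (hX : IsOpen (H : Set D.PiC)) (hρc : Continuous ρ)
    (n : ↥(Subgroup.normalizer ((H ⊓ ρ.range.comap D.augGF : Subgroup D.PiC) : Set D.PiC))) (γ : Γ) :
    D.galTransporterCEquiv H ρ hinj hH hX hρc n γ = D.galTransporter H ρ hinj hH n γ := rfl

end Transporter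

end InitialThetaData

end Literature.IUT.HodgeTheaters

end
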